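import Literature.AnabelianGeometry.AbsoluteAnabelian.AbsTopIII.KummerPlaceLaws
import Literature.AnabelianGeometry.AbsoluteAnabelian.AbsTopIII.KummerSeparationLawsV2
import HarnessLib

/-!
# [AbsTopIII] §1 law tower: the superseded layers V/VI map to their successors (v1 ⟹ v2)

Mochizuki, *Topics in Absolute Anabelian Geometry III*, §1, Thm. 1.9 (d)(e) pp. 37–38 (lit key
`paper:url-5493eb38cbb7`).

Proof-only note (abc-iut-L4-t1, interface owner) relating the SUPERSEDED layer-V/VI structures
`SeparatedKummerModel` / `PlacedKummerModel` (p430090 / p431901, abc-iut-w5-d213) to their successors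
`SeparatedKummerModelV2` / `PlacedKummerModelV2` (`KummerSeparationLawsV2.lean`, repair F-t1g4-1): the v2
degree-transport law is the v1 law WITH ONE MORE HYPOTHESIS (`cuspPt hVW c_j = none`), every other field is
verbatim, so every v1 model IS a v2 model — `SeparatedKummerModel.toV2`, `PlacedKummerModel.toV2` (the
underlying `CoherentKummerModel` is unchanged: `toV2_toCoherentKummerModel`).  Consequently every theorem
over the v2 structures specialises to v1 models; the converse fails (v1's unguarded law is false at the
intended étale-`π₁` model, which is the point of the repair).  No new definition of mathematical content
(two structure-valued abbreviations and `rfl` lemmas); nothing here bears on [IUTchIII] Cor. 3.12.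
-/

noncomputable section

namespace Literature.AnabelianGeometry.AbsoluteAnabelian.AbsTopIII

universe u

/-- **Every v1 layer-V model is a v2 layer-V model**: drop the extra hypothesis of the v2
degree-transport law. [cite: MochizukiAbsTopIII2015, Thm 1.9 (e) p.38] -/
def SeparatedKummerModel.toV2 (M : SeparatedKummerModel.{u}) : SeparatedKummerModelV2.{u} where
  toCoherentKummerModel := M.toCoherentKummerModel
  point_eq_of_finiteIndex_le_conj := M.point_eq_of_finiteIndex_le_conj
  decomp_bcPt_finiteIndex := M.decomp_bcPt_finiteIndex
  hasCuspidalDegree_transport hVW hWV hj hZZ hi hsq Pi Pj ci cj g hle _ η η' n hη :=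
    M.hasCuspidalDegree_transport hVW hWV hj hZZ hi hsq Pi Pj ci cj g hle η η' n hη

/-- The underlying layers I–IV are unchanged. [cite: MochizukiAbsTopIII2015, Thm 1.9 (e) p.38] -/
@[simp] theorem SeparatedKummerModel.toV2_toCoherentKummerModel (M : SeparatedKummerModel.{u}) :
    M.toV2.toCoherentKummerModel = M.toCoherentKummerModel :=
  rfl

/-- **Every v1 layer-VI model is a v2 layer-VI model** (layer-VI fields verbatim over `toV2`).
[cite: MochizukiAbsTopIII2015, Thm 1.9 (e) p.38] -/
def PlacedKummerModel.toV2 (M : PlacedKummerModel.{u}) : PlacedKummerModelV2.{u} where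
  toSeparatedKummerModelV2 := M.toSeparatedKummerModel.toV2
  nfPlace_eq_of_decomp_le := M.nfPlace_eq_of_decomp_le
  exists_pt_bc_open := M.exists_pt_bc_open
  exists_cusp_above_bc := M.exists_cusp_above_bc

/-- The underlying layers I–IV are unchanged. [cite: MochizukiAbsTopIII2015, Thm 1.9 (e) p.38] -/
@[simp] theorem PlacedKummerModel.toV2_toCoherentKummerModel (M : PlacedKummerModel.{u}) :
    M.toV2.toCoherentKummerModel = M.toCoherentKummerModel :=
  rfl

end Literature.AnabelianGeometry.AbsoluteAnabelian.AbsTopIII
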